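import Literature.NumberTheory.EllipticCurves.PAdicLFunctionMinusMultDistributionProofs
import Literature.NumberTheory.EllipticCurves.PAdicLFunctionMinusIntegralityAtTwoProofs
import HarnessLib

/-!
# The constant term of the odd branch `L⁻₂(f, α, ω, T)` of the ONE-TERM minus measure at `p = 2 ∣ N`:
# `∫_{ℤ₂^×} ω dμ⁻_{f,α} = α⁻² · ([1/4]⁻_f − [3/4]⁻_f)` (proofs only)

Topic `NumberTheory/EllipticCurves`; namespace `Literature.NumberTheory.EllipticCurves`. THEOREMS ONLY (no
definition, no named fact; D-0014, D-0026). The one-term twin (`ε(p) = 0`, `p ∣ N`: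
`μ⁻_{f,α}(a + pⁿℤ_p) = α⁻ⁿ[a/pⁿ]⁻_f`, file `PAdicLFunctionMinusMult`) of
`PAdicLFunctionMinusConstantTermAtTwoProofs` (the two-term measure at `p ∤ N`). At `p = 2` (`e₀ = 2`, `γ = 5`,
torsion `{±1}` of `ℤ₂^×`; `cyclotomicExponent_two`, `torsionOrder_two`) and `i = 1` (`ω = χ₋₄`, the character of
`Δ = {±1}`):

* `msdMinusMeasureMult_two_two_one_sub_three` — `μ⁻(1 + 4ℤ₂) − μ⁻(3 + 4ℤ₂) = α⁻²([1/4]⁻_f − [3/4]⁻_f)`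
  (one term each: Mazur–Tate–Teitelbaum §I.10 (10.1) with `ε(2) = 0`);
* `padicLMinusBranchMultRiemannSum_one_zero_zero_two` — the level-`0` Riemann sum of the constant term is that
  difference (the sum over the torsion `{1, −1}` of `ξ · μ⁻(ξ + 4ℤ₂)`; one inner term `s = 0`, `γ⁰ = 1`);
* `constantCoeff_padicLFunctionMinusBranchMult_one_two` — granted the distribution relation of `μ⁻_{f,α}`
  (`hdist`; for a rational newform with `2 ∣ N` and `α = a₂ ≠ 0` it is the tree's
  `sum_fiber_msdMinusMeasureMult_succ_eq_of_coeffField`),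
  `constantCoeff (padicLFunctionMinusBranchMult f α 1) = α⁻² · ([1/4]⁻_f − [3/4]⁻_f)` in `ℚ₂`
  (the Riemann sums of the constant term are constant in the level, `padicLMinusBranchMultRiemannSum_zero_eq`);
* `constantCoeff_padicLFunctionMinusBranchMult_one_two_of_coeffField` — the same for a rational newform `f`
  with `2 ∣ N`, `a₂(f) = a₂ ∈ ℤ`, `a₂ ≠ 0` (the newform of an elliptic curve with MULTIPLICATIVE reduction at
  `2`, `a₂ = ±1`), hypotheses discharged;
* `constantCoeff_padicLFunctionMinusBranchMult_one_two_of_split` / `…_of_nonsplit` — for the newform `f` of an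
  elliptic curve `W/ℚ` with SPLIT (`a₂ = 1`) resp. NON-SPLIT (`a₂ = −1`) multiplicative reduction at `2`:
  `constantCoeff (L⁻₂(f, ±1, ω, T)) = [1/4]⁻_f − [3/4]⁻_f` (`(±1)⁻² = 1`).

`[1/4]⁻ − [3/4]⁻ = Σ_{a mod 4} χ₋₄(a)[a/4]⁻_f` is the minus twisted symbol sum of the odd character `χ₋₄` of
conductor `4`; by Birch's formula (Mazur–Tate–Teitelbaum §I.8 (8.6), tree
`ratMinusTwistedSymbolSum_mul_minusPeriod_mul_I`, `τ(χ₋₄) = 2i`) it equals `2·L(f, χ₋₄, 1)/Ω⁻_f` — the `T = 0`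
interpolation of the odd branch at `2 ∣ N` (MTT §I.14 with `ε(2) = 0`: no `p`-adic multiplier). That
identification is made by the consumer (`Summits/BirchSwinnertonDyer/.../ByReductionTypeAtTwoAdditiveKatoTransportPrintExactAnyImageNonvanishing`:
`L⁻₂(f_{W′}, 1, ω, 0) ≠ 0 ⟸ L(W′ ⊗ χ₋₄, 1) ≠ 0`, the odd-branch input of Kato's divisibility for the additive
twist `W ≅ W′ ⊗ χ₋₄` of a curve `W′` split multiplicative at `2`).

Motivation (cell `bsd-2adic`, seat `bsd-2adic-k4-w3` GEN 6, crux C4″ 22618 R18): the print-level Kato doors of the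
split-twist blocks carry the binder «an integral multiple `L̃ = 2^m·L⁻ ≠ 0`»; integrality is the tree's
`exists_iwasawaToPowerSeries_eq_padicLFunctionMinusBranchMult_two` (`m = 0`), non-vanishing is this constant term.

References: B. Mazur, J. Tate, J. Teitelbaum, Invent. Math. 84 (1986) §I.4 (4.2), §I.8 (8.6), §I.10 (10.1),
§I.13, §I.14 [MazurTateTeitelbaum1986Invent].
-/

noncomputable section

open Filter Topology

open scoped MatrixGroups ModularForm

namespace Literature.NumberTheory.EllipticCurves

open CongruenceSubgroup Literature.NumberTheory.EllipticCurves.ModularForms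

variable {N : ℕ} (f : CuspForm (Gamma0 N) 2)

/-- The `2`-adic roots of unity of order dividing `2` are `±1`. [folklore] -/
private theorem coe_rootsOfUnity_two_eq_one_or_neg_one' (ξ : rootsOfUnity 2 ℤ_[2]) :
    ((ξ : ℤ_[2]ˣ) : ℤ_[2]) = 1 ∨ ((ξ : ℤ_[2]ˣ) : ℤ_[2]) = -1 := by
  have h := ξ.2
  rw [mem_rootsOfUnity] at h
  have h' : (((ξ : ℤ_[2]ˣ) : ℤ_[2])) ^ 2 = 1 := by
    rw [← Units.val_pow_eq_pow_val, h, Units.val_one]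
  exact sq_eq_one_iff.mp h'

/-- The one-term minus measure on the two unit classes modulo `4`:
`μ⁻(1 + 4ℤ₂) − μ⁻(3 + 4ℤ₂) = α⁻²[1/4]⁻ − α⁻²[3/4]⁻`.
[cite: MazurTateTeitelbaum1986Invent, §I.10 (10.1) with ε(p) = 0] -/
theorem msdMinusMeasureMult_two_two_one_sub_three (α : ℚ_[2]) :
    msdMinusMeasureMult f α 2 1 - msdMinusMeasureMult f α 2 (-1) =
      α⁻¹ ^ 2 * ((ratMinusSymbol f (1 / 4) : ℚ_[2]) - (ratMinusSymbol f (3 / 4) : ℚ_[2])) := by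
  have h1 : (1 : ZMod (2 ^ 2)).val = 1 := by decide
  have h3 : (-1 : ZMod (2 ^ 2)).val = 3 := by decide
  have hμ1 : msdMinusMeasureMult f α 2 1 = α⁻¹ ^ 2 * (ratMinusSymbol f (1 / 4) : ℚ_[2]) := by
    simp only [msdMinusMeasureMult, h1]
    norm_num
  have hμ3 : msdMinusMeasureMult f α 2 (-1) = α⁻¹ ^ 2 * (ratMinusSymbol f (3 / 4) : ℚ_[2]) := by
    simp only [msdMinusMeasureMult, h3]
    norm_num
  rw [hμ1, hμ3]
  ring

/-- **The level-`0` Riemann sum for the constant term of `L⁻₂(f, α, ω, T)` at `2 ∣ N`**: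
`padicLMinusBranchMultRiemannSum f α 1 0 0 = α⁻²([1/4]⁻ − [3/4]⁻)` — the sum over the torsion `{±1}` of
`ℤ₂^×` of `ξ · μ⁻_{f,α}(ξ + 4ℤ₂)` (one term `s = 0` of the inner sum, `γ⁰ = 1`, `C(0,0) = 1`).
[cite: MazurTateTeitelbaum1986Invent, §I.13 (p = 2)] -/
theorem padicLMinusBranchMultRiemannSum_one_zero_zero_two (α : ℚ_[2]) :
    padicLMinusBranchMultRiemannSum f α 1 0 0 =
      α⁻¹ ^ 2 * ((ratMinusSymbol f (1 / 4) : ℚ_[2]) - (ratMinusSymbol f (3 / 4) : ℚ_[2])) := by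
  classical
  -- the summand as a function of the torsion element
  set G : ℤ_[2] → ℚ_[2] := fun u ↦ ∑ s : ZMod (2 ^ 0),
    (u : ℚ_[2]) ^ 1 * msdMinusMeasureMult f α (0 + cyclotomicExponent 2)
      (PadicInt.toZModPow (0 + cyclotomicExponent 2) u *
        (cyclotomicGenerator 2 : ZMod (2 ^ (0 + cyclotomicExponent 2))) ^ s.val) *
      (s.val.choose 0 : ℚ_[2]) with hG
  have hRS : padicLMinusBranchMultRiemannSum f α 1 0 0 =
      ∑ᶠ ξ : rootsOfUnity (torsionOrder 2) ℤ_[2], G ((ξ : ℤ_[2]ˣ) : ℤ_[2]) := by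
    rw [padicLMinusBranchMultRiemannSum, hG]
  have he : 0 + cyclotomicExponent 2 = 2 := by rw [cyclotomicExponent_two]
  have hs : ∀ s : ZMod (2 ^ 0), s.val = 0 := fun s => Nat.lt_one_iff.mp (by simpa using ZMod.val_lt s)
  have hGu : ∀ u : ℤ_[2], G u = (u : ℚ_[2]) * msdMinusMeasureMult f α 2 (PadicInt.toZModPow 2 u) := by
    intro u
    rw [hG]
    dsimp only
    rw [Finset.sum_congr rfl fun s _ => by rw [hs s], Finset.sum_const, Finset.card_univ, ZMod.card,
      pow_zero, one_smul, pow_zero, mul_one, Nat.choose_zero_right, Nat.cast_one, mul_one, pow_one, he]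
  -- the torsion group at `2` is `{1, ζ}` with `ζ = -1`
  have hζmem : (-1 : ℤ_[2]ˣ) ∈ rootsOfUnity 2 ℤ_[2] := by
    rw [mem_rootsOfUnity]; norm_num
  set ζ : rootsOfUnity 2 ℤ_[2] := ⟨-1, hζmem⟩ with hζ
  have hne : (1 : rootsOfUnity 2 ℤ_[2]) ≠ ζ := by
    intro h
    have h' : (((1 : rootsOfUnity 2 ℤ_[2]) : ℤ_[2]ˣ) : ℤ_[2]) = ((ζ : ℤ_[2]ˣ) : ℤ_[2]) := by rw [h]
    rw [hζ] at h'
    simp only [OneMemClass.coe_one, Units.val_one, Units.val_neg] at h'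
    have h2 : (2 : ℤ_[2]) = 0 := by linear_combination h'
    exact two_ne_zero h2
  haveI : Fintype (rootsOfUnity 2 ℤ_[2]) := Fintype.ofFinite _
  have huniv : (Finset.univ : Finset (rootsOfUnity 2 ℤ_[2])) = {1, ζ} := by
    ext ξ
    simp only [Finset.mem_univ, Finset.mem_insert, Finset.mem_singleton, true_iff]
    rcases coe_rootsOfUnity_two_eq_one_or_neg_one' ξ with h | h
    · left
      exact Subtype.ext (Units.ext (by simpa using h))
    · right
      exact Subtype.ext (Units.ext (by rw [hζ]; simpa using h))
  rw [hRS, torsionOrder_two, finsum_eq_sum_of_fintype, huniv, Finset.sum_pair hne]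
  simp only [OneMemClass.coe_one, Units.val_one, hζ, Units.val_neg]
  rw [hGu, hGu, map_one, map_neg, map_one, PadicInt.coe_one, PadicInt.coe_neg, PadicInt.coe_one, one_mul,
    neg_one_mul, ← sub_eq_add_neg, msdMinusMeasureMult_two_two_one_sub_three]

/-- **The constant term of the odd branch of the ONE-TERM measure at `2`**: granted the distribution relation of
`μ⁻_{f,α}`, `constantCoeff (L⁻₂(f, α, ω, T)) = α⁻² · ([1/4]⁻_f − [3/4]⁻_f)` (`= α⁻² Σ_{a mod 4} χ₋₄(a)[a/4]⁻_f`).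
Proof: the constant term is the common value of the (constant) Riemann sums
(`constantCoeff_padicLFunctionMinusBranchMult_eq`, `padicLMinusBranchMultRiemannSum_zero_eq`), read at level `0`.
[cite: MazurTateTeitelbaum1986Invent, §I.13–I.14 (ε(p) = 0)] -/
theorem constantCoeff_padicLFunctionMinusBranchMult_one_two {α : ℚ_[2]}
    (hdist : ∀ (n : ℕ) (a : ZMod (2 ^ n)),
      ∑ b ∈ Finset.univ.filter (fun b : ZMod (2 ^ (n + 1)) ↦
        ZMod.castHom (pow_dvd_pow 2 n.le_succ) (ZMod (2 ^ n)) b = a), msdMinusMeasureMult f α (n + 1) b =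
        msdMinusMeasureMult f α n a) :
    PowerSeries.constantCoeff (padicLFunctionMinusBranchMult f α 1) =
      α⁻¹ ^ 2 * ((ratMinusSymbol f (1 / 4) : ℚ_[2]) - (ratMinusSymbol f (3 / 4) : ℚ_[2])) := by
  rw [constantCoeff_padicLFunctionMinusBranchMult_eq hdist 1, ← padicLMinusBranchMultRiemannSum_zero_eq hdist 1 0,
    padicLMinusBranchMultRiemannSum_one_zero_zero_two]

variable [NeZero N]

/-- **The constant term of the odd branch of the one-term measure at `2` for a RATIONAL NEWFORM** `f` of
level `N` with `2 ∣ N`, `a₂(f) = a₂ ∈ ℤ` and `a₂ ≠ 0` (the newform of an elliptic curve with multiplicative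
reduction at `2`: `a₂ = ±1`): `constantCoeff (L⁻₂(f, a₂, ω, T)) = a₂⁻² · ([1/4]⁻_f − [3/4]⁻_f)`, the distribution
relation being the tree's `sum_fiber_msdMinusMeasureMult_succ_eq_of_coeffField` (Manin–Drinfeld rationality + the
`U₂`-relation at `2 ∣ N`). [cite: MazurTateTeitelbaum1986Invent, §I.10 (10.1)–(10.2) with ε(p) = 0, §I.13] -/
theorem constantCoeff_padicLFunctionMinusBranchMult_one_two_of_coeffField (hf : IsNewform0 f)
    (hQ : coeffField f = ⊥) (h2N : 2 ∣ N) {a₂ : ℤ} (ha₂ : cuspCoeff f 2 = a₂) (ha₀ : (a₂ : ℚ_[2]) ≠ 0) :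
    PowerSeries.constantCoeff (padicLFunctionMinusBranchMult f (a₂ : ℚ_[2]) 1) =
      (a₂ : ℚ_[2])⁻¹ ^ 2 * ((ratMinusSymbol f (1 / 4) : ℚ_[2]) - (ratMinusSymbol f (3 / 4) : ℚ_[2])) :=
  constantCoeff_padicLFunctionMinusBranchMult_one_two f
    (sum_fiber_msdMinusMeasureMult_succ_eq_of_coeffField (p := 2) hf hQ h2N ha₂ ha₀)

section Curve

variable {f} {W : WeierstrassCurve ℚ}

/-- **`L⁻₂(f, 1, ω, 0) = [1/4]⁻_f − [3/4]⁻_f` for the newform `f` of an elliptic curve SPLIT multiplicative at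
`2`** (`a₂ = 1`: `IsNewformOf.cuspCoeff_eq_one_and_sq_of_split`; `2 ∣ N`: `IsNewformOf.dvd_level_of_split`).
[cite: MazurTateTeitelbaum1986Invent, §I.10 (10.1) with ε(p) = 0, §I.13–I.14] -/
theorem constantCoeff_padicLFunctionMinusBranchMult_one_two_of_split (hf : IsNewformOf W f)
    (hsp : W.HasSplitMultiplicativeReductionAtPrime 2) :
    PowerSeries.constantCoeff (padicLFunctionMinusBranchMult f (1 : ℚ_[2]) 1) =
      (ratMinusSymbol f (1 / 4) : ℚ_[2]) - (ratMinusSymbol f (3 / 4) : ℚ_[2]) := by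
  haveI : Fact (Nat.Prime 2) := ⟨Nat.prime_two⟩
  have ha₂ : cuspCoeff f 2 = ((1 : ℤ) : ℂ) := by
    rw [Int.cast_one]; exact (hf.cuspCoeff_eq_one_and_sq_of_split hsp).1
  have h := constantCoeff_padicLFunctionMinusBranchMult_one_two_of_coeffField f hf.1 hf.coeffField_eq_bot
    (hf.dvd_level_of_split hsp) ha₂ (by norm_num)
  rw [Int.cast_one] at h
  rw [h, inv_one, one_pow, one_mul]

end Curve

end Literature.NumberTheory.EllipticCurves

end
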